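/- Free-seat work of EXTRA WIDTH SEAT `ym-line-cbag-p1-w5` (prover-ym-line-cbag-p1-w5-g2-0), route `EguchiKawaiDirectionLadder`
(ideator ym-idea-2, LINE 8), crux `TripleSmallBallMargin` (stmt-QuantumFields-27724), LEAD g24's v7 architecture, glue for STUB S7 (E_rob):
RANK-ROBUST EVENTS IN PROJECTION FORM — a correction `R` of rank `≤ s` is killed by a conjugate `V·P₀·V⋆` of the rank-`r` coordinate
projection (`N = r + s`; unitary diagonalisation of `R R⋆`, counting zero eigenvalues, a permutation), so `‖X − R‖_F² ≤ a` forces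
`‖(V P₀ V⋆) X‖_F² ≤ a`, and through a `ρ`-net of the Grassmannian (stub S6, `GrNet.exists_grassmannian_net`) `‖(V′ P₀ V′⋆) X‖_F² ≤
2(a + ρ² ‖X‖_F²)` for a NET point `V′`: the rank-robust small-ball event is a finite union of fixed-projection events.  Deterministic
linear algebra, route-independent.  Nothing here bears on the Yang–Mills mass gap (barrier-ledger line onto `EguchiKawaiBreakdown`). -/
import Mathlib.Analysis.Matrix.Spectrum
import Literature.Barriers.QuantumFields.EguchiKawaiBreakdownLowerBound
import Summits.QuantumFields.YangMills.Theorems.EguchiKawaiDirectionLadderGrassmannianNetGrid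

/-!
# Route `EguchiKawaiDirectionLadder`, glue for S7: low-rank corrections are killed by a conjugate coordinate projection

* `row_eq_zero_of_eigenvalue_eq_zero` — with `U` the eigenvector unitary of the Hermitian matrix `R R⋆`, the rows of `U⋆ R` at zero
  eigenvalues vanish (`(U⋆R)(U⋆R)⋆ = diag(eigenvalues)`);
* `exists_unitary_headProj_mul_eq_zero` — if `rank R ≤ s` (`N = r + s`) there is a unitary `V` with `P₀ · (V⋆ R) = 0`, i.e. the rank-`r`
  projection `V P₀ V⋆` kills `R` (at least `r` eigenvalues of `R R⋆` vanish: `rank (R R⋆) = rank R = #{nonzero eigenvalues}`; a permutation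
  moves `r` of them to the head block);
* `exists_conjProj_frobSq_le` — hence `‖X − R‖_F² ≤ a ⇒ ∃ V, ‖(V P₀ V⋆) X‖_F² ≤ a` (`‖V P₀ V⋆‖_op ≤ 1`, tree `frobSq_mul_le`);
* `exists_mem_net_conjProj_frobSq_le` — and for any `ρ`-net `𝒩` of the conjugates of `P₀` (stub S6): `∃ V′ ∈ 𝒩,
  ‖(V′ P₀ V′⋆) X‖_F² ≤ 2(a + ρ² ‖X‖_F²)`; `lowRankEvent_subset_iUnion_net` — the set form for events `{W | ∃ R, rank R ≤ s ∧
  ‖F W − R‖_F² ≤ a}` under a uniform bound `‖F W‖_F² ≤ B`.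
-/

set_option autoImplicit false

noncomputable section

open scoped Matrix Matrix.Norms.L2Operator ComplexOrder
open Literature.Barriers.QuantumFields

namespace Summit.QuantumFields.YangMills.Theorems.EguchiKawaiDirectionLadder

namespace GrNet

/-! ### Zero rows of `U⋆ R` at zero eigenvalues of `R R⋆` -/

/-- Left multiplication by a permutation matrix permutes rows: `(P_σ M)_{ij} = M_{σ(i) j}`. -/
theorem permMatrix_mul_apply {n : ℕ} (σ : Equiv.Perm (Fin n)) (M : Matrix (Fin n) (Fin n) ℂ) (i j : Fin n) :
    (σ.permMatrix ℂ * M) i j = M (σ i) j := by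
  rw [Equiv.Perm.permMatrix, PEquiv.toMatrix_toPEquiv_mul]
  rfl

/-- With `U` the eigenvector unitary of `R R⋆`: `(U⋆ R)(U⋆ R)⋆ = diag(eigenvalues of R R⋆)`. -/
theorem star_eigenvectorUnitary_mul_mul_conjTranspose {n : ℕ} (R : Matrix (Fin n) (Fin n) ℂ) :
    ((star (Matrix.isHermitian_mul_conjTranspose_self R).eigenvectorUnitary :
        Matrix.unitaryGroup (Fin n) ℂ) : Matrix (Fin n) (Fin n) ℂ) * R *
      (((star (Matrix.isHermitian_mul_conjTranspose_self R).eigenvectorUnitary :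
        Matrix.unitaryGroup (Fin n) ℂ) : Matrix (Fin n) (Fin n) ℂ) * R)ᴴ =
      Matrix.diagonal (RCLike.ofReal ∘ (Matrix.isHermitian_mul_conjTranspose_self R).eigenvalues) := by
  set hA := Matrix.isHermitian_mul_conjTranspose_self R
  have hdiag := hA.conjStarAlgAut_star_eigenvectorUnitary
  rw [Unitary.conjStarAlgAut_star_apply] at hdiag
  rw [← hdiag, Matrix.conjTranspose_mul, Unitary.coe_star, Matrix.star_eq_conjTranspose,
    Matrix.conjTranspose_conjTranspose]
  simp only [Matrix.mul_assoc]

/-- **Rows of `U⋆ R` at zero eigenvalues of `R R⋆` vanish.** -/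
theorem row_eq_zero_of_eigenvalue_eq_zero {n : ℕ} (R : Matrix (Fin n) (Fin n) ℂ) (i : Fin n)
    (hi : (Matrix.isHermitian_mul_conjTranspose_self R).eigenvalues i = 0) (j : Fin n) :
    (((star (Matrix.isHermitian_mul_conjTranspose_self R).eigenvectorUnitary :
        Matrix.unitaryGroup (Fin n) ℂ) : Matrix (Fin n) (Fin n) ℂ) * R) i j = 0 := by
  set B : Matrix (Fin n) (Fin n) ℂ :=
    ((star (Matrix.isHermitian_mul_conjTranspose_self R).eigenvectorUnitary :
        Matrix.unitaryGroup (Fin n) ℂ) : Matrix (Fin n) (Fin n) ℂ) * R with hB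
  have hBB : (B * Bᴴ) i i = 0 := by
    rw [hB, star_eigenvectorUnitary_mul_mul_conjTranspose, Matrix.diagonal_apply_eq]
    simp [hi]
  have h1 : (B * Bᴴ) i i = ∑ j, B i j * star (B i j) := by
    simp [Matrix.mul_apply, Matrix.conjTranspose_apply]
  have h2 : ∑ j, B i j * star (B i j) = (((∑ j, ‖B i j‖ ^ 2 : ℝ)) : ℂ) := by
    push_cast
    refine Finset.sum_congr rfl fun j _ => ?_
    rw [Complex.star_def, Complex.mul_conj, Complex.normSq_eq_norm_sq]
    push_cast; ring
  rw [h1, h2] at hBB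
  have hsum : ∑ j, (‖B i j‖ ^ 2 : ℝ) = 0 := by exact_mod_cast hBB
  have hj := (Finset.sum_eq_zero_iff_of_nonneg (fun j _ => sq_nonneg (‖B i j‖))).1 hsum j (Finset.mem_univ j)
  exact norm_eq_zero.1 (pow_eq_zero_iff two_ne_zero |>.1 hj)

/-- **At least `r` eigenvalues of `R R⋆` vanish when `rank R ≤ s` (`N = r + s`).** -/
theorem card_zero_eigenvalues_ge {r s : ℕ} (R : Matrix (Fin (r + s)) (Fin (r + s)) ℂ) (hR : R.rank ≤ s) :
    r ≤ (Finset.univ.filter fun i => (Matrix.isHermitian_mul_conjTranspose_self R).eigenvalues i = 0).card := by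
  set hA := Matrix.isHermitian_mul_conjTranspose_self R
  have hrank : (R * Rᴴ).rank = Fintype.card {i // hA.eigenvalues i ≠ 0} := hA.rank_eq_card_non_zero_eigs
  rw [Matrix.rank_self_mul_conjTranspose] at hrank
  have hcompl : Fintype.card {i // ¬ (hA.eigenvalues i ≠ 0)} =
      Fintype.card (Fin (r + s)) - Fintype.card {i // hA.eigenvalues i ≠ 0} :=
    Fintype.card_subtype_compl _
  have hset : (Finset.univ.filter fun i => hA.eigenvalues i = 0).card = Fintype.card {i // ¬ (hA.eigenvalues i ≠ 0)} := by
    rw [Fintype.card_subtype]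
    congr 1
    ext i
    simp
  rw [hset, hcompl, Fintype.card_fin, ← hrank]
  omega

/-- **A correction of rank `≤ s` is killed by a conjugate of the rank-`r` coordinate projection** (`N = r + s`): there is a unitary `V`
with `P₀ · (V⋆ R) = 0`, equivalently `(V P₀ V⋆) R = 0`. -/
theorem exists_unitary_headProj_mul_eq_zero {r s : ℕ} (R : Matrix (Fin (r + s)) (Fin (r + s)) ℂ) (hR : R.rank ≤ s) :
    ∃ V : Matrix.unitaryGroup (Fin (r + s)) ℂ,
      headProj r s * (((star V : Matrix.unitaryGroup (Fin (r + s)) ℂ) : Matrix (Fin (r + s)) (Fin (r + s)) ℂ) * R) = 0 := by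
  classical
  set hA := Matrix.isHermitian_mul_conjTranspose_self R
  set U : Matrix.unitaryGroup (Fin (r + s)) ℂ := hA.eigenvectorUnitary with hU
  set Z : Finset (Fin (r + s)) := Finset.univ.filter fun i => hA.eigenvalues i = 0 with hZ
  obtain ⟨Z', hZ'Z, hcardZ'⟩ := Finset.exists_subset_card_eq (card_zero_eigenvalues_ge R hR)
  -- equivalences {x ∈ Z'} ≃ Fin r and {x ∉ Z'} ≃ Fin s
  have hc1 : Fintype.card {x // x ∈ Z'} = r := by rw [Fintype.card_coe, hcardZ']
  have hc2 : Fintype.card {x // ¬ (x ∈ Z')} = s := by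
    rw [Fintype.card_subtype_compl, Fintype.card_fin, hc1]; omega
  let e1 : {x // x ∈ Z'} ≃ Fin r := Fintype.equivFinOfCardEq hc1
  let e2 : {x // ¬ (x ∈ Z')} ≃ Fin s := Fintype.equivFinOfCardEq hc2
  let τ : Equiv.Perm (Fin (r + s)) :=
    ((Equiv.sumCompl fun x => x ∈ Z').symm.trans (e1.sumCongr e2)).trans finSumFinEquiv
  set σ : Equiv.Perm (Fin (r + s)) := τ.symm with hσ
  have hσZ : ∀ i : Fin r, σ (finSumFinEquiv (Sum.inl i)) ∈ Z := by
    intro i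
    apply hZ'Z
    have : σ (finSumFinEquiv (Sum.inl i)) = ((e1.symm i : {x // x ∈ Z'}) : Fin (r + s)) := by
      rw [hσ]
      simp [τ, Equiv.sumCongr_symm, Equiv.sumCongr_apply]
    rw [this]
    exact (e1.symm i).2
  -- V := U · P_σ⋆
  refine ⟨U * star (permUnitary σ), ?_⟩
  have hstarV : (((star (U * star (permUnitary σ)) : Matrix.unitaryGroup (Fin (r + s)) ℂ)) :
      Matrix (Fin (r + s)) (Fin (r + s)) ℂ) =
      σ.permMatrix ℂ * ((star U : Matrix.unitaryGroup (Fin (r + s)) ℂ) : Matrix (Fin (r + s)) (Fin (r + s)) ℂ) := by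
    rw [star_mul, star_star]
    rfl
  rw [hstarV, headProj_eq_diagonal]
  ext a j
  rw [Matrix.mul_assoc, Matrix.diagonal_mul, Matrix.zero_apply]
  rcases h : finSumFinEquiv.symm a with i | i
  · -- head row: a = finSumFinEquiv (inl i), so σ a ∈ Z and the row of U⋆R vanishes
    have ha : a = finSumFinEquiv (Sum.inl i) := by
      rw [← h, Equiv.apply_symm_apply]
    simp only [Sum.elim_inl, one_mul]
    rw [permMatrix_mul_apply, ha]
    have hz : hA.eigenvalues (σ (finSumFinEquiv (Sum.inl i))) = 0 := by
      have := hσZ i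
      rw [hZ, Finset.mem_filter] at this
      exact this.2
    exact row_eq_zero_of_eigenvalue_eq_zero R _ hz j
  · simp only [Sum.elim_inr, zero_mul]

/-! ### Consequences in Frobenius norm -/

/-- The conjugate projection has operator norm `≤ 1`. -/
theorem norm_conjProj_le_one {r s : ℕ} (V : Matrix.unitaryGroup (Fin (r + s)) ℂ) :
    ‖(V : Matrix (Fin (r + s)) (Fin (r + s)) ℂ) * headProj r s * (V : Matrix (Fin (r + s)) (Fin (r + s)) ℂ)ᴴ‖ ≤ 1 :=
  (norm_unitary_conj_le V (headProj r s)).trans (norm_headProj_le_one r s)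

/-- **Low rank ⇒ small after a rank-`r` projection**: if `rank R ≤ s` and `‖X − R‖_F² ≤ a` then `‖(V P₀ V⋆) X‖_F² ≤ a` for some
unitary `V` (`N = r + s`). -/
theorem exists_conjProj_frobSq_le {r s : ℕ} (X R : Matrix (Fin (r + s)) (Fin (r + s)) ℂ) (hR : R.rank ≤ s) {a : ℝ}
    (hXR : frobSq (X - R) ≤ a) :
    ∃ V : Matrix.unitaryGroup (Fin (r + s)) ℂ,
      frobSq ((V : Matrix (Fin (r + s)) (Fin (r + s)) ℂ) * headProj r s * (V : Matrix (Fin (r + s)) (Fin (r + s)) ℂ)ᴴ * X) ≤ a := by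
  obtain ⟨V, hV⟩ := exists_unitary_headProj_mul_eq_zero R hR
  refine ⟨V, ?_⟩
  have hVstar : (((star V : Matrix.unitaryGroup (Fin (r + s)) ℂ)) : Matrix (Fin (r + s)) (Fin (r + s)) ℂ) =
      (V : Matrix (Fin (r + s)) (Fin (r + s)) ℂ)ᴴ := by
    rw [Unitary.coe_star, Matrix.star_eq_conjTranspose]
  have hkill : (V : Matrix (Fin (r + s)) (Fin (r + s)) ℂ) * headProj r s * (V : Matrix (Fin (r + s)) (Fin (r + s)) ℂ)ᴴ * R = 0 := by
    simp only [Matrix.mul_assoc]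
    rw [← hVstar, hV, Matrix.mul_zero]
  have heq : (V : Matrix (Fin (r + s)) (Fin (r + s)) ℂ) * headProj r s * (V : Matrix (Fin (r + s)) (Fin (r + s)) ℂ)ᴴ * X =
      (V : Matrix (Fin (r + s)) (Fin (r + s)) ℂ) * headProj r s * (V : Matrix (Fin (r + s)) (Fin (r + s)) ℂ)ᴴ * (X - R) := by
    rw [Matrix.mul_sub, hkill, sub_zero]
  rw [heq]
  calc frobSq ((V : Matrix (Fin (r + s)) (Fin (r + s)) ℂ) * headProj r s * (V : Matrix (Fin (r + s)) (Fin (r + s)) ℂ)ᴴ * (X - R))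
      ≤ ‖(V : Matrix (Fin (r + s)) (Fin (r + s)) ℂ) * headProj r s * (V : Matrix (Fin (r + s)) (Fin (r + s)) ℂ)ᴴ‖ ^ 2 *
          frobSq (X - R) := frobSq_mul_le _ _
    _ ≤ 1 ^ 2 * frobSq (X - R) := by
        refine mul_le_mul_of_nonneg_right ?_ (frobSq_nonneg _)
        exact pow_le_pow_left₀ (norm_nonneg _) (norm_conjProj_le_one V) 2
    _ ≤ a := by rw [one_pow, one_mul]; exact hXR

/-- **Through a net**: if `𝒩` is a `ρ`-net for the conjugates of `P₀` (stub S6) then `rank R ≤ s`, `‖X − R‖_F² ≤ a` give a NET point `V′`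
with `‖(V′ P₀ V′⋆) X‖_F² ≤ 2 (a + ρ² ‖X‖_F²)`. -/
theorem exists_mem_net_conjProj_frobSq_le {r s : ℕ} {ρ : ℝ} {𝒩 : Finset (Matrix.unitaryGroup (Fin (r + s)) ℂ)}
    (hnet : ∀ U : Matrix.unitaryGroup (Fin (r + s)) ℂ, ∃ V ∈ 𝒩,
      ‖(U : Matrix (Fin (r + s)) (Fin (r + s)) ℂ) * headProj r s * (U : Matrix (Fin (r + s)) (Fin (r + s)) ℂ)ᴴ -
        (V : Matrix (Fin (r + s)) (Fin (r + s)) ℂ) * headProj r s * (V : Matrix (Fin (r + s)) (Fin (r + s)) ℂ)ᴴ‖ ≤ ρ)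
    (X R : Matrix (Fin (r + s)) (Fin (r + s)) ℂ) (hR : R.rank ≤ s) {a : ℝ} (hXR : frobSq (X - R) ≤ a) :
    ∃ V ∈ 𝒩, frobSq ((V : Matrix (Fin (r + s)) (Fin (r + s)) ℂ) * headProj r s *
      (V : Matrix (Fin (r + s)) (Fin (r + s)) ℂ)ᴴ * X) ≤ 2 * (a + ρ ^ 2 * frobSq X) := by
  obtain ⟨U, hU⟩ := exists_conjProj_frobSq_le X R hR hXR
  obtain ⟨V, hV, hUV⟩ := hnet U
  refine ⟨V, hV, ?_⟩
  set Q : Matrix (Fin (r + s)) (Fin (r + s)) ℂ :=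
    (U : Matrix (Fin (r + s)) (Fin (r + s)) ℂ) * headProj r s * (U : Matrix (Fin (r + s)) (Fin (r + s)) ℂ)ᴴ with hQ
  set Q' : Matrix (Fin (r + s)) (Fin (r + s)) ℂ :=
    (V : Matrix (Fin (r + s)) (Fin (r + s)) ℂ) * headProj r s * (V : Matrix (Fin (r + s)) (Fin (r + s)) ℂ)ᴴ with hQ'
  have hsplit : Q' * X = Q * X + (Q' - Q) * X := by rw [Matrix.sub_mul]; abel
  have hdiff : frobSq ((Q' - Q) * X) ≤ ρ ^ 2 * frobSq X := by
    calc frobSq ((Q' - Q) * X) ≤ ‖Q' - Q‖ ^ 2 * frobSq X := frobSq_mul_le _ _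
      _ ≤ ρ ^ 2 * frobSq X := by
          refine mul_le_mul_of_nonneg_right ?_ (frobSq_nonneg _)
          have : ‖Q' - Q‖ ≤ ρ := by rw [norm_sub_rev]; exact hUV
          exact pow_le_pow_left₀ (norm_nonneg _) this 2
  rw [hsplit]
  calc frobSq (Q * X + (Q' - Q) * X) ≤ 2 * frobSq (Q * X) + 2 * frobSq ((Q' - Q) * X) := frobSq_add_le _ _
    _ ≤ 2 * a + 2 * (ρ ^ 2 * frobSq X) := by linarith [hU, hdiff]
    _ = 2 * (a + ρ ^ 2 * frobSq X) := by ring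

/-- **Set form for small-ball events**: under a uniform bound `‖F W‖_F² ≤ B`, the rank-robust event
`{W | ∃ R, rank R ≤ s ∧ ‖F W − R‖_F² ≤ a}` is contained in the finite union over the net of the fixed-projection events
`{W | ‖(V′ P₀ V′⋆) F W‖_F² ≤ 2(a + ρ² B)}`. -/
theorem lowRankEvent_subset_iUnion_net {r s : ℕ} {α : Type*} (F : α → Matrix (Fin (r + s)) (Fin (r + s)) ℂ) {B : ℝ}
    (hB : ∀ W, frobSq (F W) ≤ B) {ρ : ℝ} {𝒩 : Finset (Matrix.unitaryGroup (Fin (r + s)) ℂ)}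
    (hnet : ∀ U : Matrix.unitaryGroup (Fin (r + s)) ℂ, ∃ V ∈ 𝒩,
      ‖(U : Matrix (Fin (r + s)) (Fin (r + s)) ℂ) * headProj r s * (U : Matrix (Fin (r + s)) (Fin (r + s)) ℂ)ᴴ -
        (V : Matrix (Fin (r + s)) (Fin (r + s)) ℂ) * headProj r s * (V : Matrix (Fin (r + s)) (Fin (r + s)) ℂ)ᴴ‖ ≤ ρ) (a : ℝ) :
    {W : α | ∃ R : Matrix (Fin (r + s)) (Fin (r + s)) ℂ, R.rank ≤ s ∧ frobSq (F W - R) ≤ a} ⊆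
      ⋃ V ∈ 𝒩, {W : α | frobSq ((V : Matrix (Fin (r + s)) (Fin (r + s)) ℂ) * headProj r s *
        (V : Matrix (Fin (r + s)) (Fin (r + s)) ℂ)ᴴ * F W) ≤ 2 * (a + ρ ^ 2 * B)} := by
  rintro W ⟨R, hR, hWR⟩
  obtain ⟨V, hV, hle⟩ := exists_mem_net_conjProj_frobSq_le hnet (F W) R hR hWR
  refine Set.mem_iUnion₂.2 ⟨V, hV, ?_⟩
  refine hle.trans ?_
  have := hB W
  nlinarith [sq_nonneg ρ, frobSq_nonneg (F W)]

end GrNet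

end Summit.QuantumFields.YangMills.Theorems.EguchiKawaiDirectionLadder

end
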